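import Literature.NumberTheory.LFunctions.ZetaTwistedSecondMomentBeyondHalf
import Mathlib.NumberTheory.ArithmeticFunction.VonMangoldt
import Mathlib.NumberTheory.ArithmeticFunction.Moebius
import Mathlib.Algebra.Polynomial.Eval.Defs
import HarnessLib

/-!
# The shifted twisted second moment `I(α,β)` of `ζ` and the admissible length by coefficient class
# (Pratt–Robles 2018, Theorem 1.1: generic `θ < 17/33`, Feng `θ < 6/11`, Conrey `θ < 4/7`)

Topic `Literature/NumberTheory/LFunctions` (namespace `Literature.NumberTheory.LFunctions`; the
paper's objects in the sub-namespace `PrattRobles2018`). Sibling of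
`ZetaTwistedSecondMomentBeyondHalf.lean` (Bettin–Chandee–Radziwiłł 2017, the UNSHIFTED moment
`I = ∫ |ζ(½+it)|²|A(½+it)|²φ(t/T)dt`), whose conventions it reuses verbatim: the weight class
`BettinChandeeRadziwill2017.IsTestWeight`, the coefficient class "`a_n ≪ n^ε`"
`BettinChandeeRadziwill2017.InCoeffClass`, the Dirichlet polynomial
`Literature.Barriers.RiemannHypothesis.dirichletMollifier a N = Σ_{n ≤ N} a_n n^{−s}`, and the
`ā_d a_e` placement of the complex conjugate in main terms. STATEMENT LAYER (D-0014): ONE named fact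
(Theorem 1.1, its three printed cases as one conjunction, with PROVED projections), typed for the
cell `landau-siegel` (rung F-S3, §C harvest row T-066 / P-066; tag E*-len — the in-print
"`θ_max` by coefficient class" table for `ζ`, consumer: the B-len/B-det price sheet SH-074).
The programme SEARCHES and TYPES; no claim about Landau–Siegel zeros, Theorems 1–2 of arXiv:2211.02515
or a repaired Margin232 until a kernel theorem says so.

## What the source prints (held text `paper:arxiv-1706.04593`, LaTeX source with macros stripped,
## 17 chunks, read 2026-08-26)

K. Pratt, N. Robles, *Perturbed moments and a longer mollifier for critical zeros of `ζ`*,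
Res. Number Theory 4 (2018) Art. 9 = arXiv:1706.04593 [PrattRobles2018]. §1 (chunk p0003):
"`I(α,β) := ∫_{−∞}^{∞} ζ(½+α+it) ζ(½+β−it) |A(½+it)|² Φ(t/T) dt`, where `α, β ≪ (log T)⁻¹`"
(`Φ` "a smooth function supported in `[1,2]` and with derivatives satisfying `Φ^{(j)}(x) ≪_j log^j T`";
`A(s) = Σ_{n ≤ N} a_n n^{−s}`, `N = T^θ`). "We consider three cases for the coefficients `a_n`,
namely (3cases) `a_n = O(n^ε)` for `θ < 17/33`; `a_n = μ²(n)(μ ∗ Λ^{∗k})(n) f(n)` with `f ∈ 𝓕` and for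
`θ < 6/11`; `a_n = μ(n) f(n)` with `f ∈ 𝓕` and for `θ < 4/7`. Here `𝓕` denotes the class of smooth
functions given by `f(n) = P(log(N/n)/log N)`, where `P(x)` is a polynomial."

> **Theorem 1.1** (chunk p0004:L1–15). Let `α, β ≪ L⁻¹`. Then one has
> `I(α,β) = Σ_{d,e ≤ N} (a_d ā_e/[d,e]) ((d,e)^{α+β}/(d^α e^β)) ∫_{−∞}^{∞} (ζ(1+α+β) + ζ(1−α−β)(2πde/(t(d,e)²))^{α+β}) Φ(t/T) dt + O(𝓔)`,
> with `𝓔 = T^{3/20}N^{33/20} + N^{1/2}T^{1/2+ε}` if `a_n ≪ n^ε`;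
> `𝓔 = T^ε(N^{11/6} + N^{11/12}T^{1/2})` if `a_n = μ²(n)(μ ∗ Λ^{∗k})(n)f(n)`;
> `𝓔 = T^ε(N^{7/4} + N^{7/8}T^{1/2})` if `a_n = μ(n)f(n)`, with `f ∈ 𝓕`.

"Remark 1.1. … when `α, β → 0` we obtain `lim I_M(α,β) = Σ_{d,e ≤ N} (a_d ā_e/[d,e]) ∫ (log(t(d,e)²/(2πde)) + 2C₀) Φ(t/T) dt =: I_M`,
which is the main term from [BCR]" (= the tree's `BettinChandeeRadziwill2017.mainTerm`). "Remark 1.2.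
Colloquially, this means that the length of the Feng mollifier can be 'pushed' from `θ < 17/33` to
`θ < 6/11`." (`𝓔 = o(T)` iff `N < T^{17/33}`, `T^{6/11}`, `T^{4/7}` respectively.)

## Lean rendering / design choices (audit notes for ls-lit-ref)

* `I(α,β)` = `PrattRobles2018.shiftedMoment φ T A α β`, a complex Bochner integral over `ℝ`, for any
  `A : ℂ → ℂ` (instantiated with `dirichletMollifier a N`), `|A(½+it)|²` as the real square norm.
* Main term = `PrattRobles2018.shiftedMainTerm φ T N a α β`, the printed double sum. CONJUGATION:
  the stripped source text does not show unambiguously which coefficient carries the bar; we use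
  the tree's BCR convention `ā_d a_e` together with the printed exponents `(d,e)^{α+β}/(d^α e^β)` —
  this is the main term that the diagonal/reflection computation gives for
  `|A|² = Σ_{d,e} ā_d a_e d^{−½+it} e^{−½−it}` and, renaming `d ↔ e`, equals the other reading
  `a_d ā_e (d,e)^{α+β}/(e^α d^β)`; for the real coefficient classes (Feng, Conrey) there is no
  difference at all. Complex powers are Mathlib `cpow` with positive real bases (`t > 0` on the
  support of `Φ(t/T)`, `T > 0`).
* "`α, β ≪ L⁻¹`": `∀ Cs > 0`, shifts `α, β ∈ ℂ` with `|α|, |β| ≤ Cs/log T`; the implied constant of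
  `O(𝓔)` may depend on `θ, φ, Cs, ε` and on the class data (`C` for generic, `(k, P)` for Feng, `P`
  for Conrey): "`∀ data θ φ Cs ε, ∃ K T₀, ∀ T ≥ T₀, ∀ admissible a, ∀ α β`". We REQUIRE `α + β ≠ 0`
  (the printed main term has the pole of `ζ(1+α+β)` there; the value at `α+β = 0` is the limit of
  Remark 1.1, not asserted here). `N = ⌊T^θ⌋₊` with `0 < θ < θ_max`, `θ_max = 17/33 | 6/11 | 4/7` by
  class as printed in (3cases) (erratum 2026-08-26: the first landing quantified `0 < θ < 1`; the
  all-`θ` schema `Asymptotic` is kept for the sibling `ZetaTwistedSecondMomentShiftedPair.lean`, whose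
  source [PRZZ2020, §4] prints `θ < 1`, and implies the capped `AsymptoticBelow` (`Asymptotic.below`)).
* Error terms: one shape `K · T^ε · (N^{e₁}T^{e₂} + N^{e₃}T^{e₄})` (`PrattRobles2018.Asymptotic`, a
  predicate schema in the class and the four exponents): generic `(33/20, 3/20; 1/2, 1/2)` — the
  printed `T^{3/20}N^{33/20} + N^{1/2}T^{1/2+ε}` up to the harmless extra `T^ε` on the first term
  (weaker) —, Feng `(11/6, 0; 11/12, 1/2)`, Conrey `(7/4, 0; 7/8, 1/2)`, verbatim.
* The weight: a FIXED `φ` with `IsTestWeight φ` (smooth, supported in `[1,2]`) — the sub-case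
  `Φ^{(j)} ≪_j 1 ≤ log^j T` of the printed class. -- TODO(general form): `T`-dependent weights with
  `Φ^{(j)} ≪_j log^j T`.
* Feng coefficients: `μ²(n)(μ ∗ Λ^{∗k})(n) P(log(N/n)/log N)` with Mathlib's `ArithmeticFunction`
  Dirichlet convolution (`μ` cast to `ℝ`, `Λ^k` the `k`-fold convolution power), any `k : ℕ` and any
  real polynomial `P` (the source fixes neither beyond "`f ∈ 𝓕`"); Conrey coefficients
  `μ(n) P(log(N/n)/log N)`.

INDEX ONLY (printed, not typed; type on request): **Theorem 1.2** (p0004:L47, cross moment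
`∫ ζζ A B̄ Φ` with two polynomials of lengths `T^{θ₁}, T^{θ₂}`, three error cases; "the limiting
exponent becomes `4/7`" when one factor is Conrey's, Remark 1.3); **Theorem 1.3** (p0004:L75,
`J(α,β) = ∫ ζζ|A|²|B|²Φ`, `N ≥ K`, error `T^ε(T^{1/2}N^{3/4}K + T^{1/2}NK^{1/2} + N^{7/4}K^{3/2})` — the
shifted form of the tree's `BettinChandeeRadziwill2017.theorem3`); §5 (the proportion of critical
zeros `κ ≥ .4149` from `θ₁ = 4/7 − ε`, `θ₂ = 6/11 − ε`; records live in `ZeroCounting.lean`).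

## References

* [PrattRobles2018] K. Pratt, N. Robles, Res. Number Theory 4 (2018) Art. 9 = arXiv:1706.04593: §1
  (I(α,β), (3cases), 𝓕; chunk p0003), Thm. 1.1 and Remarks 1.1–1.2 (chunk p0004:L1–45).
* [BettinChandeeRadziwill2017] S. Bettin, V. Chandee, M. Radziwiłł, J. reine angew. Math. 729 (2017)
  51–79, Thm. 1 (the generic case at `α = β = 0`; tree `ZetaTwistedSecondMomentBeyondHalf.lean`).
* J. B. Conrey, J. reine angew. Math. 399 (1989) 1–26 (the case `μ(n)f(n)`, `θ < 4/7`; tree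
  `Conrey1989MeanValue.lean`). [Conrey1989]
-/

noncomputable section

open scoped ContDiff ArithmeticFunction.Moebius ArithmeticFunction.vonMangoldt
open Finset Real Complex MeasureTheory
open Literature.Barriers.RiemannHypothesis (dirichletMollifier)

namespace Literature.NumberTheory.LFunctions

namespace PrattRobles2018

open BettinChandeeRadziwill2017 (IsTestWeight InCoeffClass mainTerm)

/-! ### The shifted moment and its printed main term -/

/-- **`I(α,β) := ∫_ℝ ζ(½+α+it) ζ(½+β−it) |A(½+it)|² Φ(t/T) dt`** (§1, (generalI)), for any
`A : ℂ → ℂ`. [cite: PrattRobles2018, §1 (definition of I(α,β))] -/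
def shiftedMoment (φ : ℝ → ℝ) (T : ℝ) (A : ℂ → ℂ) (α β : ℂ) : ℂ :=
  ∫ t : ℝ, riemannZeta (1 / 2 + α + t * I) * riemannZeta (1 / 2 + β - t * I) *
    ((‖A (1 / 2 + t * I)‖ ^ 2 : ℝ) : ℂ) * ((φ (t / T) : ℝ) : ℂ)

/-- **The printed main term of Theorem 1.1**:
`Σ_{d,e ≤ N} (ā_d a_e/[d,e]) ((d,e)^{α+β}/(d^α e^β)) ∫_ℝ (ζ(1+α+β) + ζ(1−α−β)(2πde/(t(d,e)²))^{α+β}) Φ(t/T) dt`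
(conjugate placement: module docstring). Meaningful for `α + β ≠ 0`.
[cite: PrattRobles2018, Theorem 1.1 (main term)] -/
def shiftedMainTerm (φ : ℝ → ℝ) (T : ℝ) (N : ℕ) (a : ℕ → ℂ) (α β : ℂ) : ℂ :=
  ∑ d ∈ Icc 1 N, ∑ e ∈ Icc 1 N,
    (starRingEnd ℂ (a d) * a e / ((Nat.lcm d e : ℕ) : ℂ)) *
      (((Nat.gcd d e : ℕ) : ℂ) ^ (α + β) / ((d : ℂ) ^ α * (e : ℂ) ^ β)) *
      ∫ t : ℝ, (riemannZeta (1 + (α + β)) +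
          riemannZeta (1 - (α + β)) *
            ((2 * Real.pi * d * e / (t * ((Nat.gcd d e : ℕ) : ℝ) ^ 2) : ℝ) : ℂ) ^ (α + β)) *
        ((φ (t / T) : ℝ) : ℂ)

/-! ### The coefficient classes (3cases): generic, Feng, Conrey -/

/-- The smooth factor `f(n) = P(log(N/n)/log N)` of the class `𝓕`.
[cite: PrattRobles2018, §1 (the class 𝓕)] -/
def smoothFactor (P : Polynomial ℝ) (N n : ℕ) : ℝ :=
  P.eval (Real.log ((N : ℝ) / n) / Real.log N)

/-- **Feng coefficients** `a_n = μ²(n) (μ ∗ Λ^{∗k})(n) f(n)`, `f(n) = P(log(N/n)/log N)` (second case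
of (3cases); Dirichlet convolution and convolution power of Mathlib's `ArithmeticFunction`).
[cite: PrattRobles2018, §1 (3cases)] -/
def fengCoeff (k : ℕ) (P : Polynomial ℝ) (N : ℕ) (n : ℕ) : ℂ :=
  ((((μ n : ℤ) : ℝ) ^ 2 * ((μ : ArithmeticFunction ℝ) * Λ ^ k) n * smoothFactor P N n : ℝ) : ℂ)

/-- **Conrey coefficients** `a_n = μ(n) f(n)`, `f(n) = P(log(N/n)/log N)` (third case of (3cases)).
[cite: PrattRobles2018, §1 (3cases)] -/
def conreyCoeff (P : Polynomial ℝ) (N : ℕ) (n : ℕ) : ℂ :=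
  ((((μ n : ℤ) : ℝ) * smoothFactor P N n : ℝ) : ℂ)

/-- `a_1 = P(1)` for the Conrey coefficients when `N ≥ 2` (`μ(1) = 1`, `log(N/1)/log N = 1`).
[cite: PrattRobles2018, §1 (3cases)] -/
theorem conreyCoeff_one (P : Polynomial ℝ) {N : ℕ} (hN : 2 ≤ N) :
    conreyCoeff P N 1 = ((P.eval 1 : ℝ) : ℂ) := by
  have hN' : (1 : ℝ) < N := by exact_mod_cast hN
  have hlog : Real.log (N : ℝ) ≠ 0 := Real.log_ne_zero_of_pos_of_ne_one (by linarith) hN'.ne'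
  simp [conreyCoeff, smoothFactor, div_self hlog]

/-! ### The asymptotic as a schema in the class and the error exponents -/

/-- **The asymptotic of Theorem 1.1 for a coefficient class** — a predicate SCHEMA: the class is a
family `adm : ι → ℕ → (ℕ → ℂ) → Prop` of admissibility conditions indexed by data `i : ι` on which
the implied constant may depend (`adm i N a`: "`a` is admissible of length `N` for the data `i`"),
and the error is `K · T^ε · (N^{e₁} T^{e₂} + N^{e₃} T^{e₄})`, `N = ⌊T^θ⌋₊`, `0 < θ < 1`, shifts
`|α|, |β| ≤ Cs/log T` with `α + β ≠ 0`, fixed test weight `φ`.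
[cite: PrattRobles2018, Theorem 1.1] -/
def Asymptotic (ι : Type) (adm : ι → ℕ → (ℕ → ℂ) → Prop) (e₁ e₂ e₃ e₄ : ℝ) : Prop :=
  ∀ i : ι, ∀ θ : ℝ, 0 < θ → θ < 1 → ∀ φ : ℝ → ℝ, IsTestWeight φ →
    ∀ Cs : ℝ, 0 < Cs → ∀ ε : ℝ, 0 < ε →
      ∃ K T₀ : ℝ, ∀ T : ℝ, T₀ ≤ T → ∀ a : ℕ → ℂ, adm i ⌊T ^ θ⌋₊ a →
        ∀ α β : ℂ, ‖α‖ ≤ Cs / Real.log T → ‖β‖ ≤ Cs / Real.log T → α + β ≠ 0 →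
          ‖shiftedMoment φ T (dirichletMollifier a ⌊T ^ θ⌋₊) α β -
              shiftedMainTerm φ T ⌊T ^ θ⌋₊ a α β‖ ≤
            K * T ^ ε * (((⌊T ^ θ⌋₊ : ℕ) : ℝ) ^ e₁ * T ^ e₂ + ((⌊T ^ θ⌋₊ : ℕ) : ℝ) ^ e₃ * T ^ e₄)

/-- **The asymptotic of Theorem 1.1 for a coefficient class UP TO THE CLASS'S LENGTH `θ < θ_max`**
(erratum schema, 2026-08-26, REF-C BOUNCE of p458504): the same predicate as `Asymptotic` but
quantified over `0 < θ < θ_max` only — the print ties each coefficient class to its range in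
(3cases) ("`a_n = O(n^ε)` for `θ < 17/33`; … for `θ < 6/11`; … for `θ < 4/7`") and states Theorem 1.1
for those cases. `Asymptotic ι adm …` (all `θ < 1`) implies `AsymptoticBelow ι adm θ_max …` for every
`θ_max ≤ 1` (`Asymptotic.below`). [cite: PrattRobles2018, §1 (3cases) and Theorem 1.1] -/
def AsymptoticBelow (ι : Type) (adm : ι → ℕ → (ℕ → ℂ) → Prop) (θmax e₁ e₂ e₃ e₄ : ℝ) : Prop :=
  ∀ i : ι, ∀ θ : ℝ, 0 < θ → θ < θmax → ∀ φ : ℝ → ℝ, IsTestWeight φ →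
    ∀ Cs : ℝ, 0 < Cs → ∀ ε : ℝ, 0 < ε →
      ∃ K T₀ : ℝ, ∀ T : ℝ, T₀ ≤ T → ∀ a : ℕ → ℂ, adm i ⌊T ^ θ⌋₊ a →
        ∀ α β : ℂ, ‖α‖ ≤ Cs / Real.log T → ‖β‖ ≤ Cs / Real.log T → α + β ≠ 0 →
          ‖shiftedMoment φ T (dirichletMollifier a ⌊T ^ θ⌋₊) α β -
              shiftedMainTerm φ T ⌊T ^ θ⌋₊ a α β‖ ≤
            K * T ^ ε * (((⌊T ^ θ⌋₊ : ℕ) : ℝ) ^ e₁ * T ^ e₂ + ((⌊T ^ θ⌋₊ : ℕ) : ℝ) ^ e₃ * T ^ e₄)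

/-- The all-`θ < 1` schema implies the capped one for every cap `θ_max ≤ 1`. [cite: PrattRobles2018, Theorem 1.1] -/
theorem Asymptotic.below {ι : Type} {adm : ι → ℕ → (ℕ → ℂ) → Prop} {e₁ e₂ e₃ e₄ : ℝ}
    (h : Asymptotic ι adm e₁ e₂ e₃ e₄) {θmax : ℝ} (hθ : θmax ≤ 1) :
    AsymptoticBelow ι adm θmax e₁ e₂ e₃ e₄ :=
  fun i θ hθ0 hθ1 => h i θ hθ0 (lt_of_lt_of_le hθ1 hθ)

/-- Generic admissibility: "`a_n ≪ n^ε`" with the family of implied constants `C` (any length).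
[cite: PrattRobles2018, §1 (3cases)] -/
def admGeneric (C : ℝ → ℝ) (_N : ℕ) (a : ℕ → ℂ) : Prop :=
  InCoeffClass C a

/-- Feng admissibility: `a` IS the Feng sequence for the data `(k, P)` and the length `N`.
[cite: PrattRobles2018, §1 (3cases)] -/
def admFeng (kP : ℕ × Polynomial ℝ) (N : ℕ) (a : ℕ → ℂ) : Prop :=
  a = fengCoeff kP.1 kP.2 N

/-- Conrey admissibility: `a` IS the Conrey sequence for the data `P` and the length `N`.
[cite: PrattRobles2018, §1 (3cases)] -/
def admConrey (P : Polynomial ℝ) (N : ℕ) (a : ℕ → ℂ) : Prop :=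
  a = conreyCoeff P N

end PrattRobles2018

open PrattRobles2018

/-- **Pratt–Robles 2018, Theorem 1.1** (NAMED FACT, AS PRINTED, the three cases as one conjunction):
`I(α,β) = [printed main term] + O(𝓔)` for `|α|, |β| ≤ Cs/log T`, `α + β ≠ 0`, `N = T^θ`, with
`𝓔 ≪ T^ε(T^{3/20}N^{33/20} + N^{1/2}T^{1/2})` for `a_n ≪ n^ε` (GENERIC; non-trivial for `θ < 17/33`),
`𝓔 ≪ T^ε(N^{11/6} + N^{11/12}T^{1/2})` for `a_n = μ²(n)(μ∗Λ^{∗k})(n)f(n)` (FENG; `θ < 6/11`),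
`𝓔 ≪ T^ε(N^{7/4} + N^{7/8}T^{1/2})` for `a_n = μ(n)f(n)` (CONREY; `θ < 4/7`), `f(n) = P(log(N/n)/log N)`.
Each case is asserted ONLY in its printed length range ((3cases): "for `θ < 17/33`", "for `θ < 6/11`",
"for `θ < 4/7`") via the capped schema `PrattRobles2018.AsymptoticBelow` — ERRATUM 2026-08-26 (REF-C
BOUNCE of the first landing p458504, whose schema quantified every case over all `0 < θ < 1`; the
statement was narrowed to the print, nothing else changed; no decl outside this file used the fact).
Projections: `prattRobles2018_theorem11.generic/.feng/.conrey`. Status: theorem-in-print, not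
proved here (BCR's method with the Bettin–Chandee trilinear bound, plus Type I/II structure of the
Feng coefficients and incomplete Kloosterman sums, §§2–4 of the source).
[cite: PrattRobles2018, Theorem 1.1] -/
def prattRobles2018_theorem11 : Prop :=
  AsymptoticBelow (ℝ → ℝ) admGeneric (17 / 33) (33 / 20) (3 / 20) (1 / 2) (1 / 2) ∧
    AsymptoticBelow (ℕ × Polynomial ℝ) admFeng (6 / 11) (11 / 6) 0 (11 / 12) (1 / 2) ∧
      AsymptoticBelow (Polynomial ℝ) admConrey (4 / 7) (7 / 4) 0 (7 / 8) (1 / 2)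

/-- The GENERIC case (`θ < θ_max = 17/33`). [cite: PrattRobles2018, Theorem 1.1 (case a_n ≪ n^ε)] -/
theorem prattRobles2018_theorem11.generic (h : prattRobles2018_theorem11) :
    AsymptoticBelow (ℝ → ℝ) admGeneric (17 / 33) (33 / 20) (3 / 20) (1 / 2) (1 / 2) :=
  h.1

/-- The FENG case (`θ < θ_max = 6/11`). [cite: PrattRobles2018, Theorem 1.1 (case μ²(μ∗Λ^{∗k})f)] -/
theorem prattRobles2018_theorem11.feng (h : prattRobles2018_theorem11) :
    AsymptoticBelow (ℕ × Polynomial ℝ) admFeng (6 / 11) (11 / 6) 0 (11 / 12) (1 / 2) :=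
  h.2.1

/-- The CONREY case (`θ < θ_max = 4/7`). [cite: PrattRobles2018, Theorem 1.1 (case μ f)] -/
theorem prattRobles2018_theorem11.conrey (h : prattRobles2018_theorem11) :
    AsymptoticBelow (Polynomial ℝ) admConrey (4 / 7) (7 / 4) 0 (7 / 8) (1 / 2) :=
  h.2.2

/-- **The `θ_max`-by-class table, as arithmetic**: the first error monomial `N^{e₁}T^{e₂}` with
`N = T^θ` is `T^{θe₁+e₂}`, which is `< T` exactly when `θ < (1 − e₂)/e₁`; for the three printed
cases this threshold is `17/33`, `6/11`, `4/7` (and the second monomial gives the weaker thresholds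
`1`, `6/11`, `4/7`). Pure arithmetic, recorded for the price sheet. [cite: PrattRobles2018, Remark 1.2] -/
theorem PrattRobles2018.thetaMax_table :
    (1 - 3 / 20 : ℝ) / (33 / 20) = 17 / 33 ∧ (1 - 0 : ℝ) / (11 / 6) = 6 / 11 ∧
      (1 - 0 : ℝ) / (7 / 4) = 4 / 7 ∧ (1 - 1 / 2 : ℝ) / (11 / 12) = 6 / 11 ∧
        (1 - 1 / 2 : ℝ) / (7 / 8) = 4 / 7 := by
  norm_num

end Literature.NumberTheory.LFunctions

end
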